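import Summits.BirchSwinnertonDyer.BirchSwinnertonDyer.Theorems.ManinLocalTwoThreeStevensCurveRational
import Literature.NumberTheory.EllipticCurves.ModularParamYFunction
import Literature.NumberTheory.EllipticCurves.PeriodLatticeODETransportProofs
import Literature.NumberTheory.EllipticCurves.EichlerShimuraPeriodsGamma1
import HarnessLib

/-!
# The `y`-pair: a (rational) `Γ₁(N)`-presentation of `℘′_{Λ}(ℰ_f)` from one of `℘_{Λ}(ℰ_f)` — the first Rankin–Cohen bracket on `Γ₁(N)`
(route `ManinLocalTwoThree`, crux C2 stmt-BirchSwinnertonDyer-22967; cell bsd-f2-manin, prover p3 gen 21; step (0y) of the T-es-75 discharge road, asked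
for by p2 gen 23 (STATUS 08:10Z: «YES please add the y-pair (Fʸ, Gʸ) with Gʸ·℘′_Λ(ℰ_f) = Fʸ rational») and listed by the LEAD p1 gen 22)

The tree's `ModularParamYFunction.bracketCusp` is `Γ₀(N)`-only.  For `F, G ∈ S_k(Γ₁(N))` presenting `x = ℘_Λ(ℰ_f)` (`℘_Λ(ℰ_f)·G = F` off the
poles, `G ≠ 0`) we construct — as an EXISTENCE statement, no definition — the pair
`Fʸ = G·ϑ_kF − F·ϑ_kG = (2πi)⁻¹(G·F′ − F·G′) ∈ S_{2k+2}(Γ₁(N))` (Mathlib `serreDerivative`, `serreDerivative_slash_equivariant`) and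
`Gʸ = G·(G·f) ∈ S_{2k+2}(Γ₁(N))`, with **`℘′_Λ(ℰ_f τ)·Gʸ(τ) = Fʸ(τ)` whenever `ℰ_f(τ) ∉ Λ`** (chain rule `(℘_Λ∘ℰ_f)′ = ℘′_Λ(ℰ_f)·2πi f` against
`(F/G)′`), `Gʸ ≠ 0`, and **rational Fourier coefficients for `Fʸ, Gʸ` when `F, G, f` have rational coefficients** (`qexp Fʸ = b·θa − a·θb`,
`qexp Gʸ = b²e`, `θ = q d/dq`; the tree's tracked `q`-expansion calculus `qexp_track_*`).  With `…StevensCurveRatPresentation` /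
`…StevensCurveRatPresentationDatum` this gives both coordinates of `φ₁ = u_{E₁}∘ℰ_f` on the Stevens curve as ratios of RATIONAL cusp forms on `Γ₁(N)` —
the input of p2's `CuspValues.qExpansion_coeff_eq_weierstrassP_mul_of_presentation` (+ `℘′` twin) and of the LEAD's `qExpansion_slash_conj`.

* `cuspForm_slash_eq_gamma1`, `isZeroAtImInfty_serreDerivative_slash_gamma1`, `bracket_slash_gamma1` — `Γ₁(N)` twins of the `Γ₀(N)` lemmas;
* `exists_ratSeries_of_cuspCoeff` — a form with rational coefficients has `qexp = P ⊗ ℂ`, `P ∈ ℚ⟦q⟧`;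
* `exists_gamma1_yPresentation` — the `y`-pair with its identity, non-vanishing, pointwise formulas and rationality clause.

HONEST FRAMING: analytic bookkeeping; no named fact; nothing about T-es-75, C2/C3, Manin's conjecture or BSD is proved here.
[cite: Zagier2008, §5.2] [cite: CremonaAlgorithms1997, §2.10] [cite: DiamondShurman2005, §1.1]
-/

set_option autoImplicit false
-- lint-debt: the directory name repeats the summit name (sibling precedent `ManinLocalTwoThreeStevensCurveRatPresentation.lean`)
set_option linter.dupNamespace false

noncomputable section

open Complex Filter Topology Set Function PowerSeries
open UpperHalfPlane hiding I
open scoped Real Topology Manifold MatrixGroups PeriodPair ModularForm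
open ModularForm CongruenceSubgroup Derivative
open Literature.NumberTheory.EllipticCurves Literature.NumberTheory.EllipticCurves.ModularForms

namespace Summit.BirchSwinnertonDyer.BirchSwinnertonDyer.Theorems.ManinLocalTwoThree.StevensCurve

variable {N : ℕ} [NeZero N] {k : ℤ}

/-! ### `Γ₁(N)` twins of the slash lemmas -/

omit [NeZero N] in
/-- A cusp form on `Γ₁(N)` is invariant under `Γ₁(N) ≤ SL(2, ℤ)`. [folklore] -/
theorem cuspForm_slash_eq_gamma1 (F : CuspForm (Gamma1 N) k) {γ : SL(2, ℤ)} (hγ : γ ∈ Gamma1 N) :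
    (⇑F) ∣[k] γ = ⇑F := by
  rw [ModularForm.SL_slash]
  exact SlashInvariantForm.slash_action_eqn F _ (Subgroup.mem_map_of_mem (Matrix.SpecialLinearGroup.mapGL ℝ) hγ)

/-- The Serre derivative of an `SL(2, ℤ)`-translate of a cusp form on `Γ₁(N)` vanishes at `i∞`. [folklore] -/
theorem isZeroAtImInfty_serreDerivative_slash_gamma1 (F : CuspForm (Gamma1 N) k) (γ : SL(2, ℤ)) :
    IsZeroAtImInfty (serreDerivative k ((⇑F) ∣[k] γ)) := by
  have hφ := isCuspFunction_slash_gamma1 F γ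
  have h1 : IsZeroAtImInfty (D ((⇑F) ∣[k] γ)) :=
    isZeroAtImInfty_normalizedDeriv hφ.pos hφ.periodic hφ.mdifferentiable hφ.isBoundedAtImInfty
  have h2 : Tendsto (fun τ : ℍ ↦ (k : ℂ) * 12⁻¹ * EisensteinSeries.E2 τ * ((⇑F) ∣[k] γ) τ) atImInfty (𝓝 0) := by
    have := ((tendsto_E2_atImInfty.const_mul ((k : ℂ) * 12⁻¹)).mul hφ.isZeroAtImInfty)
    rw [mul_zero] at this
    exact this
  have hs : serreDerivative k ((⇑F) ∣[k] γ) = fun z ↦ D ((⇑F) ∣[k] γ) z -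
      k * 12⁻¹ * EisensteinSeries.E2 z * ((⇑F) ∣[k] γ) z := rfl
  rw [hs]
  have := h1.sub h2
  rw [sub_zero] at this
  exact this

omit [NeZero N] in
/-- The bracket commutes with `SL(2, ℤ)`-translation (Serre-derivative equivariance). [folklore] -/
theorem bracket_slash_gamma1 (F G : CuspForm (Gamma1 N) k) (γ : SL(2, ℤ)) :
    (⇑G * serreDerivative k ⇑F - ⇑F * serreDerivative k ⇑G) ∣[k + (k + 2)] γ =
      (⇑G ∣[k] γ) * serreDerivative k (⇑F ∣[k] γ) - (⇑F ∣[k] γ) * serreDerivative k (⇑G ∣[k] γ) := by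
  rw [sub_eq_add_neg, SlashAction.add_slash, SlashAction.neg_slash, ModularForm.mul_slash_SL2,
    ModularForm.mul_slash_SL2, serreDerivative_slash_equivariant (k := k) (ModularFormClass.holo F),
    serreDerivative_slash_equivariant (k := k) (ModularFormClass.holo G), ← sub_eq_add_neg]

/-! ### Rational `q`-series bookkeeping -/

/-- A series all of whose coefficients are rational is the image of a rational series. [folklore] -/
theorem exists_ratSeries_of_forall_rat {a : ℂ⟦X⟧} (h : ∀ n, ∃ q : ℚ, (q : ℂ) = coeff n a) :
    ∃ P : ℚ⟦X⟧, P.map (algebraMap ℚ ℂ) = a := by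
  choose q hq using h
  refine ⟨PowerSeries.mk q, ?_⟩
  ext n
  rw [coeff_map, coeff_mk, ← hq n]
  simp

/-- `θ = q d/dq` commutes with `ℚ → ℂ`. [folklore] -/
theorem mk_natCast_mul_coeff_map (P : ℚ⟦X⟧) :
    (PowerSeries.mk fun n ↦ (n : ℂ) * coeff n (P.map (algebraMap ℚ ℂ))) =
      (PowerSeries.mk fun n ↦ (n : ℚ) * coeff n P).map (algebraMap ℚ ℂ) := by
  ext n
  rw [coeff_mk, coeff_map, coeff_map, coeff_mk]
  simp

/-- Coefficients of the image of a rational series are rational. [folklore] -/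
theorem forall_rat_of_eq_map {a : ℂ⟦X⟧} (P : ℚ⟦X⟧) (h : a = P.map (algebraMap ℚ ℂ)) :
    ∀ n, ∃ q : ℚ, (q : ℂ) = coeff n a := fun n ↦
  ⟨coeff n P, by rw [h, coeff_map]; simp⟩

/-! ### The `y`-pair -/

/-- **The `y`-pair on `Γ₁(N)`.**  Let `f ∈ S₂(Γ₀(N))`, `f ≠ 0`, `L` a period pair, and `F, G ∈ S_k(Γ₁(N))`, `G ≠ 0`, with `℘_L(ℰ_f τ)·G(τ) = F(τ)`
whenever `ℰ_f(τ) ∉ Λ(L)`.  Then there are `Fʸ, Gʸ ∈ S_{k+(k+2)}(Γ₁(N))` with `Gʸ ≠ 0`, `Gʸ = G·(G·f)`, `Fʸ = (2πi)⁻¹(G·F′ − F·G′)` (the first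
Rankin–Cohen bracket `G·ϑF − F·ϑG`), **`℘′_L(ℰ_f τ)·Gʸ(τ) = Fʸ(τ)` whenever `ℰ_f(τ) ∉ Λ(L)`**, and: if `F`, `G`, `f` have rational Fourier coefficients,
so do `Fʸ` and `Gʸ` (`qexp Gʸ = b²e`, `qexp Fʸ = b·θa − a·θb`). [cite: Zagier2008, §5.2] [cite: CremonaAlgorithms1997, §2.10] -/
theorem exists_gamma1_yPresentation (f : CuspForm (Gamma0 N) 2) (hf : f ≠ 0) (L : PeriodPair) (F G : CuspForm (Gamma1 N) k)
    (hG : G ≠ 0) (hFG : ∀ τ : ℍ, eichlerIntegral f τ ∉ L.lattice → ℘[L] (eichlerIntegral f τ) * G τ = F τ) :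
    ∃ (Fy Gy : CuspForm (Gamma1 N) (k + (k + 2))), Gy ≠ 0 ∧
      (∀ τ : ℍ, eichlerIntegral f τ ∉ L.lattice → ℘'[L] (eichlerIntegral f τ) * Gy τ = Fy τ) ∧
      (∀ τ : ℍ, Gy τ = G τ * (G τ * f τ)) ∧
      (∀ τ : ℍ, Fy τ = (2 * π * I)⁻¹ * (G τ * deriv (⇑F ∘ ofComplex) τ - F τ * deriv (⇑G ∘ ofComplex) τ)) ∧
      ((∀ n, ∃ q : ℚ, (q : ℂ) = cuspCoeff F n) → (∀ n, ∃ q : ℚ, (q : ℂ) = cuspCoeff G n) →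
        (∀ n, ∃ q : ℚ, (q : ℂ) = cuspCoeff f n) →
        (∀ n, ∃ q : ℚ, (q : ℂ) = cuspCoeff Fy n) ∧ (∀ n, ∃ q : ℚ, (q : ℂ) = cuspCoeff Gy n)) := by
  have h2pi : (2 * π * I : ℂ) ≠ 0 := by simp [Real.pi_ne_zero]
  -- the denominator `Gʸ = G·(G·f)`
  have hGyslash : ∀ γ : SL(2, ℤ), (⇑G * (⇑G * ⇑f)) ∣[k + (k + 2)] γ = (⇑G ∣[k] γ) * ((⇑G ∣[k] γ) * (⇑f ∣[(2 : ℤ)] γ)) := by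
    intro γ
    rw [ModularForm.mul_slash_SL2, ModularForm.mul_slash_SL2]
  let Gy : CuspForm (Gamma1 N) (k + (k + 2)) :=
    { toFun := ⇑G * (⇑G * ⇑f)
      slash_action_eq' := fun A hA ↦ by
        obtain ⟨γ, hγ, rfl⟩ := hA
        change (⇑G * (⇑G * ⇑f)) ∣[k + (k + 2)] γ = _
        rw [hGyslash, cuspForm_slash_eq_gamma1 G hγ, cuspForm_slash_eq f (Gamma1_in_Gamma0 N hγ)]
      holo' := (ModularFormClass.holo G).mul ((ModularFormClass.holo G).mul (ModularFormClass.holo f))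
      zero_at_cusps' := fun {c} hc ↦ by
        rw [Subgroup.IsArithmetic.isCusp_iff_isCusp_SL2Z] at hc
        rw [OnePoint.isZeroAt_iff_forall_SL2Z hc]
        intro γ _
        change IsZeroAtImInfty ((⇑G * (⇑G * ⇑f)) ∣[k + (k + 2)] γ)
        rw [hGyslash]
        have h1 : Tendsto (⇑G ∣[k] γ) atImInfty (𝓝 0) := (isCuspFunction_slash_gamma1 G γ).isZeroAtImInfty
        have h3 : Tendsto (⇑f ∣[(2 : ℤ)] γ) atImInfty (𝓝 0) := (isCuspFunction_slash f γ).isZeroAtImInfty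
        have := h1.mul (h1.mul h3)
        rw [mul_zero, mul_zero] at this
        exact this }
  -- the numerator `Fʸ = G·ϑF − F·ϑG`
  let Fy : CuspForm (Gamma1 N) (k + (k + 2)) :=
    { toFun := ⇑G * serreDerivative k ⇑F - ⇑F * serreDerivative k ⇑G
      slash_action_eq' := fun A hA ↦ by
        obtain ⟨γ, hγ, rfl⟩ := hA
        change (⇑G * serreDerivative k ⇑F - ⇑F * serreDerivative k ⇑G) ∣[k + (k + 2)] γ = _
        rw [bracket_slash_gamma1, cuspForm_slash_eq_gamma1 F hγ, cuspForm_slash_eq_gamma1 G hγ]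
      holo' := ((ModularFormClass.holo G).mul (serreDerivative_mdifferentiable k (ModularFormClass.holo F))).sub
        ((ModularFormClass.holo F).mul (serreDerivative_mdifferentiable k (ModularFormClass.holo G)))
      zero_at_cusps' := fun {c} hc ↦ by
        rw [Subgroup.IsArithmetic.isCusp_iff_isCusp_SL2Z] at hc
        rw [OnePoint.isZeroAt_iff_forall_SL2Z hc]
        intro γ _
        change IsZeroAtImInfty ((⇑G * serreDerivative k ⇑F - ⇑F * serreDerivative k ⇑G) ∣[k + (k + 2)] γ)
        rw [bracket_slash_gamma1]
        have h1 : Tendsto (⇑G ∣[k] γ) atImInfty (𝓝 0) := (isCuspFunction_slash_gamma1 G γ).isZeroAtImInfty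
        have h2 : Tendsto (serreDerivative k (⇑F ∣[k] γ)) atImInfty (𝓝 0) :=
          isZeroAtImInfty_serreDerivative_slash_gamma1 F γ
        have h3 : Tendsto (⇑F ∣[k] γ) atImInfty (𝓝 0) := (isCuspFunction_slash_gamma1 F γ).isZeroAtImInfty
        have h4 : Tendsto (serreDerivative k (⇑G ∣[k] γ)) atImInfty (𝓝 0) :=
          isZeroAtImInfty_serreDerivative_slash_gamma1 G γ
        have := (h1.mul h2).sub (h3.mul h4)
        rw [mul_zero, sub_zero] at this
        exact this }
  have hGy_apply : ∀ τ : ℍ, Gy τ = G τ * (G τ * f τ) := fun τ ↦ rfl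
  have hFy_apply : ∀ τ : ℍ, Fy τ = (2 * π * I)⁻¹ * (G τ * deriv (⇑F ∘ ofComplex) τ - F τ * deriv (⇑G ∘ ofComplex) τ) := by
    intro τ
    change (⇑G * serreDerivative k ⇑F - ⇑F * serreDerivative k ⇑G) τ = _
    simp only [Pi.sub_apply, Pi.mul_apply, serreDerivative_apply, normalizedDerivOfComplex]
    ring
  refine ⟨Fy, Gy, ?_, fun τ hτ ↦ ?_, hGy_apply, hFy_apply, fun hFr hGr hfr ↦ ?_⟩
  · -- `Gʸ ≠ 0`
    obtain ⟨τ₁, hτ₁⟩ := DFunLike.ne_iff.mp hG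
    have hG1 : G τ₁ ≠ 0 := by simpa using hτ₁
    -- `f ≠ 0` near `τ₁`? use instead a point where both `G` and `f` are nonzero: zeros are countable
    have hf₁ : liftToGamma1 N 2 f ≠ 0 := by
      intro h0
      apply hf
      apply DFunLike.ext
      intro τ
      have h1 := DFunLike.congr_fun h0 τ
      rw [coe_liftToGamma1_holds N 2 f] at h1
      exact h1
    have hcount : (({z : ℂ | 0 < z.im} ∩ (⇑G ∘ ofComplex) ⁻¹' {0}) ∪
        ({z : ℂ | 0 < z.im} ∩ (⇑(liftToGamma1 N 2 f) ∘ ofComplex) ⁻¹' {0})).Countable :=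
      (countable_zeros_cuspForm G hG).union (countable_zeros_cuspForm (liftToGamma1 N 2 f) hf₁)
    obtain ⟨z₂, hz₂⟩ := nonempty_diff_of_countable hcount
    have hz₂im : 0 < z₂.im := hz₂.1
    simp only [Set.mem_sdiff, mem_union, mem_inter_iff, mem_preimage, mem_singleton_iff, mem_setOf_eq, not_or, not_and] at hz₂
    have hGz : (⇑G ∘ ofComplex) z₂ ≠ 0 := hz₂.2.1 hz₂im
    have hfz : (⇑f ∘ ofComplex) z₂ ≠ 0 := by
      have h := hz₂.2.2 hz₂im
      rwa [coe_liftToGamma1_holds N 2 f] at h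
    intro h0
    have h1 := DFunLike.congr_fun h0 (ofComplex z₂)
    have h2 : Gy (ofComplex z₂) = G (ofComplex z₂) * (G (ofComplex z₂) * f (ofComplex z₂)) := rfl
    rw [h2] at h1
    simp only [comp_apply] at hGz hfz
    exact (mul_ne_zero hGz (mul_ne_zero hGz hfz)) (by simpa using h1)
  · -- the identity `℘'(ℰ_f τ)·G(Gf) = Fʸ` off the poles
    rw [hGy_apply, hFy_apply]
    by_cases hGτ : G τ = 0
    · have hFτ : F τ = 0 := by rw [← hFG τ hτ, hGτ, mul_zero]
      rw [hGτ, hFτ]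
      ring
    · -- differentiate `℘_L(ℰ_f) = F/G` near `τ`
      set z : ℂ := (τ : ℂ) with hz
      have hzim : 0 < z.im := τ.im_pos
      have hτz : ofComplex z = τ := by rw [hz, ofComplex_apply]
      have hFan := (isCuspFunction_one_gamma1 F).analyticAt_comp_ofComplex hzim
      have hGan := (isCuspFunction_one_gamma1 G).analyticAt_comp_ofComplex hzim
      have hGz : (⇑G ∘ ofComplex) z ≠ 0 := by simpa [comp_apply, hτz] using hGτ
      have hΛo : IsOpen ((L.lattice : Set ℂ)ᶜ) := L.isClosed_lattice.isOpen_compl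
      have hUc : ContinuousAt (fun w : ℂ ↦ eichlerIntegral f (ofComplex w)) z :=
        (analyticAt_eichlerIntegral_comp_ofComplex f hzim).continuousAt
      have hτΛ : eichlerIntegral f (ofComplex z) ∉ L.lattice := by rwa [hτz]
      have ev0 : ∀ᶠ w in 𝓝 z, 0 < w.im := isOpen_upperHalfPlaneSet.mem_nhds hzim
      have ev1 : ∀ᶠ w in 𝓝 z, (⇑G ∘ ofComplex) w ≠ 0 := hGan.continuousAt.eventually_ne hGz
      have ev2 : ∀ᶠ w in 𝓝 z, eichlerIntegral f (ofComplex w) ∉ L.lattice :=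
        hUc.preimage_mem_nhds (hΛo.mem_nhds hτΛ)
      have hev : (fun w : ℂ ↦ ℘[L] (eichlerIntegral f (ofComplex w))) =ᶠ[𝓝 z]
          fun w : ℂ ↦ (⇑F ∘ ofComplex) w / (⇑G ∘ ofComplex) w := by
        filter_upwards [ev0, ev1, ev2] with w h0 h1 h2
        have h := hFG (ofComplex w) h2
        simp only [comp_apply] at h1 ⊢
        rw [eq_div_iff h1, h]
      -- derivatives of both sides
      have hu := hasDerivAt_eichlerIntegral f hzim
      have h℘ := L.hasDerivAt_weierstrassP hτΛ
      have hcomp : HasDerivAt (fun w : ℂ ↦ ℘[L] (eichlerIntegral f (ofComplex w)))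
          (℘'[L] (eichlerIntegral f (ofComplex z)) * (2 * π * Complex.I * f (ofComplex z))) z :=
        HasDerivAt.comp (h₂ := ℘[L]) (h := fun w : ℂ ↦ eichlerIntegral f (ofComplex w)) z h℘ hu
      have hquot : HasDerivAt (fun w : ℂ ↦ (⇑F ∘ ofComplex) w / (⇑G ∘ ofComplex) w)
          ((deriv (⇑F ∘ ofComplex) z * (⇑G ∘ ofComplex) z - (⇑F ∘ ofComplex) z * deriv (⇑G ∘ ofComplex) z) /
            (⇑G ∘ ofComplex) z ^ 2) z :=
        (hFan.differentiableAt.hasDerivAt).div (hGan.differentiableAt.hasDerivAt) hGz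
      have heq := hcomp.deriv.symm.trans ((hev.deriv_eq).trans hquot.deriv)
      simp only [comp_apply, hτz] at heq hGz
      rw [hz] at heq
      -- algebra
      have hGτ' : G τ ≠ 0 := hGτ
      field_simp
      field_simp at heq
      linear_combination heq
  · -- rationality
    obtain ⟨PF, hPF⟩ := exists_ratSeries_of_forall_rat (a := qExpansion 1 ⇑F) hFr
    obtain ⟨PG, hPG⟩ := exists_ratSeries_of_forall_rat (a := qExpansion 1 ⇑G) hGr
    obtain ⟨Pf, hPf⟩ := exists_ratSeries_of_forall_rat (a := qExpansion 1 ⇑f) hfr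
    have hFc : IsCuspFunction 1 ⇑F := isCuspFunction_one_gamma1 F
    have hGc : IsCuspFunction 1 ⇑G := isCuspFunction_one_gamma1 G
    have hfc : IsCuspFunction 1 ⇑f := isCuspFunction_one f
    -- `qexp Gʸ = b·(b·e)`
    obtain ⟨hGf, eGf⟩ := qexp_track_mul hGc hPG.symm hfc hPf.symm
    obtain ⟨-, eGy⟩ := qexp_track_mul hGc hPG.symm hGf eGf
    have hGyq : qExpansion 1 ⇑Gy = (PG * (PG * Pf)).map (algebraMap ℚ ℂ) := by
      change qExpansion 1 (⇑G * (⇑G * ⇑f)) = _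
      rw [eGy, map_mul, map_mul]
    -- `qexp Fʸ = b·θa − a·θb`
    obtain ⟨hdF, edF⟩ := qexp_track_deriv hFc hPF.symm
    obtain ⟨hdG, edG⟩ := qexp_track_deriv hGc hPG.symm
    obtain ⟨h1, e1⟩ := qexp_track_mul hGc hPG.symm hdF edF
    obtain ⟨h2, e2⟩ := qexp_track_mul hFc hPF.symm hdG edG
    obtain ⟨hW, eW⟩ := qexp_track_sub h1 e1 h2 e2
    obtain ⟨-, eFy'⟩ := qexp_track_smul hW eW ((2 * π * I)⁻¹ : ℂ)
    have hFyfun : (⇑Fy : ℍ → ℂ) = ((2 * π * I)⁻¹ : ℂ) •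
        (⇑G * (fun τ : ℍ ↦ deriv (⇑F ∘ ofComplex) τ) - ⇑F * (fun τ : ℍ ↦ deriv (⇑G ∘ ofComplex) τ)) := by
      funext τ
      rw [hFy_apply τ]
      simp only [Pi.smul_apply, Pi.sub_apply, Pi.mul_apply, smul_eq_mul]
    have hC : (PowerSeries.C ((2 * π * I)⁻¹ : ℂ)) * PowerSeries.C (2 * π * I) = 1 := by
      rw [← map_mul, inv_mul_cancel₀ h2pi, map_one]
    have key : ∀ b a T₁ T₂ : ℂ⟦X⟧, PowerSeries.C ((2 * π * I)⁻¹ : ℂ) * (b * (PowerSeries.C (2 * π * I) * T₁) - a * (PowerSeries.C (2 * π * I) * T₂)) =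
        b * T₁ - a * T₂ := by
      intro b a T₁ T₂
      linear_combination (b * T₁ - a * T₂) * hC
    have hFyq : qExpansion 1 ⇑Fy =
        (PG * (PowerSeries.mk fun n ↦ (n : ℚ) * coeff n PF) - PF * (PowerSeries.mk fun n ↦ (n : ℚ) * coeff n PG)).map (algebraMap ℚ ℂ) := by
      rw [hFyfun, eFy', key, mk_natCast_mul_coeff_map PF, mk_natCast_mul_coeff_map PG, map_sub, map_mul, map_mul]
    exact ⟨forall_rat_of_eq_map _ hFyq, forall_rat_of_eq_map _ hGyq⟩

end Summit.BirchSwinnertonDyer.BirchSwinnertonDyer.Theorems.ManinLocalTwoThree.StevensCurve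

end
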